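import Summits.KontsevichZagierPeriods.KontsevichZagierPeriods.Theorems.RootDecompZetaThreeFrontierRungFourPreludeP09

/-! # `RootDecompZetaThreeFrontierRungFourPreludeP10` — part 10/14 of the mechanical ≤400-line split of `pre_src.lean` (sha256 ba362a5194d75c20…)
Source: decomp-kz lens-1 g12/g13 rung-4 prelude = Prelude_v3.lean @ba362a51 (Basis22_v1 sections RotFour/Shuffle/ProdFour/GenFb/WordMoves/RungFour/Basis22 + FacetGeneric_v2 §1–§23; critic CLEARED g6 row 330 / g6-20 l.1368); --supports stmt-KontsevichZagierPeriods-27141.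
Split by census-1 g10 `gen/splitlean.py`: scopes re-opened with their `open`/`variable`/`set_option` context; mathematics and declaration order unchanged. -/

set_option linter.dupNamespace false
open MeasureTheory Set
open Literature.NumberTheory.Transcendental
set_option linter.dupNamespace false
namespace Summit.KontsevichZagierPeriods.KontsevichZagierPeriods.Cruxes.GZNormalFormWThree.GZLadder.RungFour
open Summit.KontsevichZagierPeriods.KontsevichZagierPeriods.Cruxes.GZNormalFormWThree.GZLadder.FacetFour
  (not_integrableOn_of_residue)
section TailFacet
variable {M : ℕ}
set_option linter.unusedSimpArgs false

/-- the head minimum `x_{j-1}` (or `1` if the head is empty): the section bound for `p_j` -/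
def headMinT (j : Fin (M + 1)) (x : Fin M → ℝ) : ℝ :=
  if h : (j : ℕ) = 0 then 1 else x ⟨(j : ℕ) - 1, by omega⟩

/-- Auxiliary step `headMinT_pos`: head Min T pos. [bookkeeping] -/
theorem headMinT_pos {j : Fin (M + 1)} {x : Fin M → ℝ} (hx : x ∈ baseT j) : 0 < headMinT j x := by
  unfold headMinT; split_ifs
  · exact one_pos
  · exact (hx.1 _).1

/-- Auxiliary step `headMinT_le_one`: head Min T le one. [bookkeeping] -/
theorem headMinT_le_one {j : Fin (M + 1)} {x : Fin M → ℝ} (hx : x ∈ baseT j) : headMinT j x ≤ 1 := by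
  unfold headMinT; split_ifs
  · exact le_rfl
  · exact (hx.1 _).2.le

/-- Auxiliary step `headMinT_le`: head Min T le. [bookkeeping] -/
theorem headMinT_le {j : Fin (M + 1)} {x : Fin M → ℝ} (hx : x ∈ baseT j) (i : Fin M) (hi : (i : ℕ) < j) :
    headMinT j x ≤ x i := by
  unfold headMinT
  rw [dif_neg (by omega)]
  rcases (show (i : ℕ) < j - 1 ∨ (i : ℕ) = j - 1 by omega) with h | h
  · exact (hx.2.1 i ⟨(j : ℕ) - 1, by omega⟩ (Fin.lt_def.2 (by simpa using h))
      (by simp only [Fin.val_mk]; omega)).le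
  · have : (⟨(j : ℕ) - 1, by omega⟩ : Fin M) = i := Fin.ext (by simp only [Fin.val_mk]; omega)
    rw [this]

/-- Auxiliary step `continuous_headMinT`: continuous head Min T. [bookkeeping] -/
theorem continuous_headMinT (j : Fin (M + 1)) : Continuous (headMinT (M := M) j) := by
  unfold headMinT; split_ifs <;> fun_prop

/-- Auxiliary step `isOpen_baseT`: is Open base T. [bookkeeping] -/
theorem isOpen_baseT (j : Fin (M + 1)) : IsOpen (baseT (M := M) j) := by
  have e : baseT (M := M) j = (⋂ i, {x : Fin M → ℝ | 0 < x i} ∩ {x | x i < 1}) ∩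
      (⋂ i : Fin M, ⋂ i' : Fin M, {x : Fin M → ℝ | i < i' → (i' : ℕ) < j → x i' < x i}) ∩
      (⋂ i : Fin M, ⋂ i' : Fin M, {x : Fin M → ℝ | i < i' → (j : ℕ) ≤ i → x i' < x i}) := by
    ext p; simp only [baseT, Set.mem_setOf_eq, Set.mem_inter_iff, Set.mem_iInter]; exact and_assoc.symm
  rw [e]
  refine ((isOpen_iInter_of_finite fun i => ?_).inter (isOpen_iInter_of_finite fun i =>
    isOpen_iInter_of_finite fun i' => ?_)).inter (isOpen_iInter_of_finite fun i => isOpen_iInter_of_finite fun i' => ?_)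
  · exact (isOpen_lt continuous_const (continuous_apply i)).inter (isOpen_lt (continuous_apply i) continuous_const)
  · by_cases h : i < i' ∧ (i' : ℕ) < j
    · have : {x : Fin M → ℝ | i < i' → (i' : ℕ) < j → x i' < x i} = {x | x i' < x i} := by
        ext p; simp only [Set.mem_setOf_eq]; exact ⟨fun hp => hp h.1 h.2, fun hp _ _ => hp⟩
      rw [this]; exact isOpen_lt (continuous_apply i') (continuous_apply i)
    · have : {x : Fin M → ℝ | i < i' → (i' : ℕ) < j → x i' < x i} = Set.univ := by
        ext p; simp only [Set.mem_setOf_eq, Set.mem_univ, iff_true]; exact fun h1 h2 => absurd ⟨h1, h2⟩ h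
      rw [this]; exact isOpen_univ
  · by_cases h : i < i' ∧ (j : ℕ) ≤ i
    · have : {x : Fin M → ℝ | i < i' → (j : ℕ) ≤ i → x i' < x i} = {x | x i' < x i} := by
        ext p; simp only [Set.mem_setOf_eq]; exact ⟨fun hp => hp h.1 h.2, fun hp _ _ => hp⟩
      rw [this]; exact isOpen_lt (continuous_apply i') (continuous_apply i)
    · have : {x : Fin M → ℝ | i < i' → (j : ℕ) ≤ i → x i' < x i} = Set.univ := by
        ext p; simp only [Set.mem_setOf_eq, Set.mem_univ, iff_true]; exact fun h1 h2 => absurd ⟨h1, h2⟩ h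
      rw [this]; exact isOpen_univ

/-- SECTION: `x ∈ baseT j`, `0 < t < headMinT j x` ⟹ `insertNth j t x ∈ domT j` -/
theorem insT_mem_domT {j : Fin (M + 1)} {x : Fin M → ℝ} (hx : x ∈ baseT j) {t : ℝ} (ht0 : 0 < t)
    (ht1 : t < headMinT j x) : (Fin.insertNth j t x : Fin (M + 1) → ℝ) ∈ domT j := by
  have hj := j.isLt
  have ht1' : t < 1 := lt_of_lt_of_le ht1 (headMinT_le_one hx)
  obtain ⟨h01, hh, htl⟩ := hx
  refine ⟨fun i => ?_, fun i i' hlt h' => ?_, fun i i' hlt h => ?_⟩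
  · rcases lt_trichotomy i j with h | h | h
    · rw [insT_lt j t x i h]; exact h01 _
    · rw [h, insT_self]; exact ⟨ht0, ht1'⟩
    · rw [insT_gt j t x i h]; exact h01 _
  · have hi : i < j := lt_of_lt_of_le hlt h'
    rw [insT_lt j t x i hi]
    rcases h'.lt_or_eq with h2 | h2
    · rw [insT_lt j t x i' h2]
      have hlt' : (i : ℕ) < i' := hlt
      have h2' : (i' : ℕ) < j := h2
      exact hh _ _ (Fin.mk_lt_mk.2 hlt') h2'
    · rw [h2, insT_self]
      have hi' : (i : ℕ) < j := hi
      exact lt_of_lt_of_le ht1 (headMinT_le ⟨h01, hh, htl⟩ _ hi')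
  · have hi' : j < i' := h.trans hlt
    rw [insT_gt j t x i h, insT_gt j t x i' hi']
    have h1 : (j : ℕ) < i := h
    have h2 : (i : ℕ) < i' := hlt
    exact htl _ _ (Fin.mk_lt_mk.2 (by omega)) (by simp only [Fin.val_mk]; omega)

/-- POSITIVITY of the reduced forms on `baseT j × [0, headMinT)` -/
theorem redT_pos (j : Fin (M + 1)) (c : Chord (M + 1)) {x : Fin M → ℝ} (hx : x ∈ baseT j) {a : ℝ}
    (ha0 : 0 ≤ a) (ha1 : a < headMinT j x) : 0 < redT j c (x, a) := by
  have hj := j.isLt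
  have ha1' : a < 1 := lt_of_lt_of_le ha1 (headMinT_le_one hx)
  have hmin := headMinT_le hx
  obtain ⟨h01, hh, htl⟩ := hx
  obtain ⟨i, l, hil, proper⟩ := c
  have hil' : (i : ℕ) < l := hil
  have hl3 := l.isLt
  unfold redT
  simp only
  by_cases hc : (j : ℕ) + 1 ≤ i
  · -- cluster chord
    rw [if_pos hc]
    unfold ylabT
    by_cases hi1 : (i : ℕ) = j + 1
    · rw [if_pos hi1, if_neg (by omega)]
      by_cases hl1 : (l : ℕ) ≤ M + 1
      · rw [dif_pos ⟨hl1, by omega⟩]; linarith [(h01 ⟨(l : ℕ) - 2, by omega⟩).2]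
      · rw [dif_neg (by omega)]; norm_num
    · rw [if_neg hi1, dif_pos ⟨by omega, by omega⟩, if_neg (by omega)]
      by_cases hl1 : (l : ℕ) ≤ M + 1
      · rw [dif_pos ⟨hl1, by omega⟩]
        exact sub_pos.2 (htl ⟨(i : ℕ) - 2, by omega⟩ ⟨(l : ℕ) - 2, by omega⟩ (Fin.mk_lt_mk.2 (by omega))
          (by simp only [Fin.val_mk]; omega))
      · rw [dif_neg (by omega), sub_zero]; exact (h01 _).1
  · -- non-cluster chord: `i ≤ j`
    rw [if_neg hc]
    simp only [Chord.form, xpt_mapT_insT]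
    by_cases hi0 : (i : ℕ) = 0
    · rw [dif_pos hi0, dif_neg (show ¬ ((l : ℕ) = 0) by omega)]
      by_cases hl1 : (l : ℕ) ≤ j
      · rw [dif_pos hl1]; linarith [(h01 ⟨(l : ℕ) - 1, by omega⟩).2]
      rw [dif_neg hl1]
      by_cases hl2 : (l : ℕ) = j + 1
      · rw [dif_pos hl2]; linarith
      rw [dif_neg hl2]
      by_cases hl4 : (l : ℕ) ≤ M + 1
      · rw [dif_pos hl4]
        have hx2 := h01 ⟨(l : ℕ) - 2, by omega⟩
        nlinarith [hx2.1, hx2.2]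
      · rw [dif_neg hl4]; norm_num
    rw [dif_neg hi0, dif_pos (show (i : ℕ) ≤ j by omega)]
    have hxi := h01 ⟨(i : ℕ) - 1, by omega⟩
    have hmi : headMinT j x ≤ x ⟨(i : ℕ) - 1, by omega⟩ := hmin _ (by simp only [Fin.val_mk]; omega)
    rw [dif_neg (show ¬ ((l : ℕ) = 0) by omega)]
    by_cases hl1 : (l : ℕ) ≤ j
    · rw [dif_pos hl1]
      exact sub_pos.2 (hh ⟨(i : ℕ) - 1, by omega⟩ ⟨(l : ℕ) - 1, by omega⟩ (Fin.mk_lt_mk.2 (by omega))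
        (by simp only [Fin.val_mk]; omega))
    rw [dif_neg hl1]
    by_cases hl2 : (l : ℕ) = j + 1
    · rw [dif_pos hl2]; linarith
    rw [dif_neg hl2]
    by_cases hl4 : (l : ℕ) ≤ M + 1
    · rw [dif_pos hl4]
      have hx2 := h01 ⟨(l : ℕ) - 2, by omega⟩
      nlinarith [hx2.1, hx2.2]
    · rw [dif_neg hl4]; linarith [hxi.1]

/-- number of cluster chords of a family -/
noncomputable def nT (j : Fin (M + 1)) (S : Fin (M + 1) → Chord (M + 1)) : ℕ :=
  (Finset.univ.filter fun m => (j : ℕ) + 1 ≤ (S m).i).card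

/-- the cleared product identity at `p = insertNth j t x`, clearing exponent `E ≥ nT` -/
theorem prod_form_mapT_insT (j : Fin (M + 1)) (S : Fin (M + 1) → Chord (M + 1)) {E : ℕ} (hS : nT j S ≤ E)
    (x : Fin M → ℝ) {t : ℝ} (ht : t ≠ 0) :
    (∏ m, 1 / (S m).form (mapT j (Fin.insertNth j t x))) * t ^ E =
      t ^ (E - nT j S) * ∏ m, 1 / redT j (S m) (x, t) := by
  classical
  simp only [form_mapT_insT]
  rw [show (fun m => 1 / ((if (j : ℕ) + 1 ≤ (S m).i then t else 1) * redT j (S m) (x, t))) =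
      fun m => (1 / (if (j : ℕ) + 1 ≤ (S m).i then t else 1)) * (1 / redT j (S m) (x, t)) from
      funext fun m => by rw [one_div_mul_one_div], Finset.prod_mul_distrib]
  have h1 : (∏ m, 1 / (if (j : ℕ) + 1 ≤ (S m).i then t else (1:ℝ))) = 1 / t ^ nT j S := by
    rw [Finset.prod_div_distrib, Finset.prod_const_one]
    congr 1
    rw [← Finset.prod_filter, Finset.prod_const]
    rfl
  rw [h1]
  have h3 : t ^ E = t ^ nT j S * t ^ (E - nT j S) := by rw [← pow_add, Nat.add_sub_cancel' hS]
  rw [h3]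
  field_simp

/-- the cleared term -/
noncomputable def gTermT (j : Fin (M + 1)) (S : Fin (M + 1) → Chord (M + 1)) (z : (Fin M → ℝ) × ℝ) : ℝ :=
  z.2 ^ (tailCard j + 1 - nT j S) * ∏ m, 1 / redT j (S m) z

open Classical in
/-- the RESIDUE along the tail facet `{t_j, …, t_M, 0}` -/
noncomputable def resT (j : Fin (M + 1)) (F : Finset (Fin (M + 1) → Chord (M + 1)))
    (q : (Fin (M + 1) → Chord (M + 1)) → ℚ) (x : Fin M → ℝ) : ℝ :=
  ∑ S ∈ F, if nT j S = tailCard j + 1 then (q S : ℝ) * ∏ m, 1 / redT j (S m) (x, 0) else 0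

open Classical in
/-- Auxiliary step `gTermT_zero`: g Term T zero. [bookkeeping] -/
theorem gTermT_zero (j : Fin (M + 1)) (S : Fin (M + 1) → Chord (M + 1)) (hS : nT j S ≤ tailCard j + 1)
    (x : Fin M → ℝ) (q : ℚ) :
    (q : ℝ) * gTermT j S (x, 0) =
      if nT j S = tailCard j + 1 then (q : ℝ) * ∏ m, 1 / redT j (S m) (x, 0) else 0 := by
  unfold gTermT
  by_cases h : nT j S = tailCard j + 1
  · rw [if_pos h, h]; simp
  · rw [if_neg h, zero_pow (by omega)]; simp

/-- Auxiliary step `continuous_mapT`: continuous map T. [bookkeeping] -/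
theorem continuous_mapT (j : Fin (M + 1)) : Continuous (mapT j) := by
  refine continuous_pi fun i => ?_
  by_cases h : i ≤ j
  · simp only [mapT, if_pos h]; fun_prop
  · simp only [mapT, if_neg h]; fun_prop

/-- Auxiliary step `continuous_ylabT`: continuous ylab T. [bookkeeping] -/
theorem continuous_ylabT (j : Fin (M + 1)) (l : Fin (M + 3)) : Continuous fun x : Fin M → ℝ => ylabT j x l := by
  unfold ylabT; split_ifs <;> fun_prop

/-- Auxiliary step `continuous_redT`: continuous red T. [bookkeeping] -/
theorem continuous_redT (j : Fin (M + 1)) (c : Chord (M + 1)) : Continuous (redT j c) := by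
  unfold redT
  split_ifs
  · exact ((continuous_ylabT j _).comp continuous_fst).sub ((continuous_ylabT j _).comp continuous_fst)
  · exact (continuous_form c).comp ((continuous_mapT j).comp (continuous_insertNth_pair' j))

/-- Auxiliary step `continuousOn_gTermT`: continuous On g Term T. [bookkeeping] -/
theorem continuousOn_gTermT (j : Fin (M + 1)) (S : Fin (M + 1) → Chord (M + 1)) {K : Set (Fin M → ℝ)}
    (hK : K ⊆ baseT j) {η₀ : ℝ} (hη : ∀ x ∈ K, η₀ < headMinT j x) :
    ContinuousOn (gTermT j S) (K ×ˢ Icc 0 η₀) := by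
  unfold gTermT
  refine ContinuousOn.mul (by fun_prop) (continuousOn_finsetProd _ fun m _ => ?_)
  refine ContinuousOn.div continuousOn_const (continuous_redT j (S m)).continuousOn fun z hz => ?_
  obtain ⟨hz1, hz2⟩ := hz
  have := redT_pos j (S m) (hK hz1) hz2.1 (lt_of_le_of_lt hz2.2 (hη z.1 hz1))
  exact this.ne'

/-- (F-tail, generic `k = M+1`, any `j`): pulled back through `T_j` (Jacobian `p_j ^ tailCard j`), an integrable
frame-monomial combination with at most `tailCard j + 1` cluster chords per family (true for frames) has
vanishing residue along `p_j → 0` on `baseT j`. -/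
theorem resT_eq_zero (j : Fin (M + 1)) (F : Finset (Fin (M + 1) → Chord (M + 1)))
    (q : (Fin (M + 1) → Chord (M + 1)) → ℚ) (hclus : ∀ S ∈ F, nT j S ≤ tailCard j + 1)
    (hint : IntegrableOn (fun p : Fin (M + 1) → ℝ =>
      (∑ S ∈ F, (q S : ℝ) * ∏ m, 1 / (S m).form (mapT j p)) * p j ^ tailCard j) (domT j)) :
    ∀ x ∈ baseT j, resT j F q x = 0 := by
  classical
  set G : (Fin M → ℝ) × ℝ → ℝ := fun z => ∑ S ∈ F, (q S : ℝ) * gTermT j S z with hGdef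
  have hG0 : ∀ x, G (x, 0) = resT j F q x := fun x => by
    simp only [hGdef, resT]
    exact Finset.sum_congr rfl fun S hS => gTermT_zero j S (hclus S hS) x (q S)
  by_contra hcon
  push Not at hcon
  obtain ⟨x₁, hx₁, hR⟩ := hcon
  set a := headMinT j x₁ with ha
  have ha0 : 0 < a := headMinT_pos hx₁
  have ha1 : a ≤ 1 := headMinT_le_one hx₁
  set U : Set (Fin M → ℝ) := baseT j ∩ {x | a / 2 < headMinT j x} with hU
  have hUopen : IsOpen U := (isOpen_baseT j).inter (isOpen_lt continuous_const (continuous_headMinT j))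
  have hx₁U : x₁ ∈ U := ⟨hx₁, by show a / 2 < headMinT j x₁; rw [← ha]; linarith⟩
  have hcontU : ContinuousOn (fun x => G (x, 0)) U := by
    have h1 : ContinuousOn G (U ×ˢ Icc 0 (a / 2)) := by
      refine continuousOn_finsetSum _ fun S hS => ContinuousOn.mul continuousOn_const ?_
      exact continuousOn_gTermT j S (fun x hx => hx.1) (fun x hx => hx.2)
    refine h1.comp (Continuous.continuousOn (by fun_prop)) fun x hx => ⟨hx, ⟨le_rfl, by linarith⟩⟩
  have hcontAt : ContinuousAt (fun x => G (x, 0)) x₁ := hcontU.continuousAt (hUopen.mem_nhds hx₁U)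
  have hne₁ : G (x₁, 0) ≠ 0 := by rw [hG0]; exact hR
  have hev : ∀ᶠ y in nhds x₁, G (y, 0) ≠ 0 := hcontAt.eventually_ne hne₁
  obtain ⟨ρ₁, hρ₁, hball₁⟩ := Metric.eventually_nhds_iff_ball.1 hev
  obtain ⟨ρ₂, hρ₂, hball₂⟩ := Metric.isOpen_iff.1 hUopen x₁ hx₁U
  set ρ := min ρ₁ ρ₂ / 2 with hρ
  have hρpos : 0 < ρ := by positivity
  set K := Metric.closedBall x₁ ρ with hK
  have hKU : K ⊆ U := fun y hy => hball₂ (Metric.mem_ball.2 (lt_of_le_of_lt (Metric.mem_closedBall.1 hy)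
    (by rw [hρ]; linarith [min_le_right ρ₁ ρ₂])))
  have hKne0 : ∀ y ∈ K, G (y, 0) ≠ 0 := fun y hy => hball₁ y (Metric.mem_ball.2
    (lt_of_le_of_lt (Metric.mem_closedBall.1 hy) (by rw [hρ]; linarith [min_le_left ρ₁ ρ₂])))
  refine not_integrableOn_of_residue j (isOpen_domT j).measurableSet _ K
    (isCompact_closedBall x₁ ρ) (Metric.measure_closedBall_pos volume x₁ hρpos).ne' (η₀ := a / 2)
    (by positivity) (by linarith) (fun x hx t ht => ?_) G ?_ (fun x hx t ht => ?_) hKne0 hint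
  · have hxU := hKU hx
    exact insT_mem_domT hxU.1 ht.1 (lt_trans ht.2 hxU.2)
  · refine continuousOn_finsetSum _ fun S hS => ContinuousOn.mul continuousOn_const ?_
    exact continuousOn_gTermT j S (fun x hx => (hKU hx).1) (fun x hx => (hKU hx).2)
  · simp only [hGdef, gTermT, insT_self]
    rw [Finset.sum_mul, Finset.sum_mul]
    refine Finset.sum_congr rfl fun S hS => ?_
    have := prod_form_mapT_insT j S (hclus S hS) x (t := t) ht.1.ne'
    calc (q S : ℝ) * (∏ m, 1 / (S m).form (mapT j (Fin.insertNth j t x))) * t ^ tailCard j * t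
        = (q S : ℝ) * ((∏ m, 1 / (S m).form (mapT j (Fin.insertNth j t x))) * t ^ (tailCard j + 1)) := by ring
      _ = (q S : ℝ) * (t ^ (tailCard j + 1 - nT j S) * ∏ m, 1 / redT j (S m) (x, t)) := by rw [this]

/-- CLUSTER BOUND for frames: cluster gap vectors live on the `tailCard j + 1` gaps `l ≥ j+1` -/
theorem IsFrame.nT_le {S : Fin (M + 1) → Chord (M + 1)} (hS : IsFrame S) (j : Fin (M + 1)) :
    nT j S ≤ tailCard j + 1 := by
  classical
  have hj := j.isLt
  set T : Finset (Fin (M + 2)) := Finset.univ.filter fun l => (j : ℕ) + 1 ≤ l with hT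
  have hcard : T.card = tailCard j + 1 := by
    rw [tailCard_eq]
    have e : T = Finset.Ici (⟨(j : ℕ) + 1, by omega⟩ : Fin (M + 2)) := by
      ext l; simp [hT, Fin.le_def]
    rw [e, Fin.card_Ici]
    simp
    omega
  rw [← hcard]
  refine hS.card_filter_le (fun c => (j : ℕ) + 1 ≤ c.i) T fun c hc l hl => ?_
  unfold Chord.vec
  rw [if_neg]
  rintro ⟨h1, h2⟩
  apply hl
  simp only [hT, Finset.mem_filter, Finset.mem_univ, true_and]
  exact hc.trans h1

/-- **(F-tail) PACKAGED, generic `k = M+1`, any slot `j`**: an integrable frame combination on `Δ_{M+1}` has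
vanishing residue along the tail facet `{t_j, …, t_M, 0}`. -/
theorem facet_tail (j : Fin (M + 1)) (F : Finset (Fin (M + 1) → Chord (M + 1)))
    (q : (Fin (M + 1) → Chord (M + 1)) → ℚ) (hF : ∀ S ∈ F, IsFrame S)
    (hint : IntegrableOn (fun t : Fin (M + 1) → ℝ => ∑ S ∈ F, (q S : ℝ) * ∏ m, 1 / (S m).form t)
      (KZ.openOrderedSimplex (M + 1))) :
    ∀ x ∈ baseT j, resT j F q x = 0 :=
  resT_eq_zero j F q (fun S hS => (hF S hS).nT_le j) ((integrableOn_pullT_iff j _).1 hint)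

/-- … and along the reflected facets `{1, t_0, …, t_{M-j}}` (apply `facet_tail` to the reflected data) -/
theorem facet_tail_refl (j : Fin (M + 1)) (F : Finset (Fin (M + 1) → Chord (M + 1)))
    (q : (Fin (M + 1) → Chord (M + 1)) → ℚ) (hF : ∀ S ∈ F, IsFrame S)
    (hint : IntegrableOn (fun t : Fin (M + 1) → ℝ => ∑ S ∈ F, (q S : ℝ) * ∏ m, 1 / (S m).form t)
      (KZ.openOrderedSimplex (M + 1))) :
    ∀ x ∈ baseT j, resT j (F.map ⟨reflFam, reflFam_injective⟩) (fun S' => q (reflFam S')) x = 0 := by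
  refine facet_tail j _ _ (fun S' hS' => ?_) ?_
  · obtain ⟨S, hS, rfl⟩ := Finset.mem_map.1 hS'
    exact isFrame_reflFam (hF S hS)
  · have h := (integrableOn_reflPt_iff _).1 hint
    refine (integrableOn_congr_fun (fun t _ => ?_) (KZ.measurableSet_openOrderedSimplex (M + 1))).1 h
    exact sum_reflFam F q t

end TailFacet

/-! ## §19 GENERIC RUN-CLUSTER CHART (any `k = M+1`, any inner run `a < b` of point indices): the two-step chart
`R_{a,b} = ψ ∘ σ` — `σ` scales the interior shapes by `ε = p_b` (UPPER triangular, `det = ε^{#(a,b)}`), `ψ` passes to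
the relative coordinates `t_i = t_a − q_i` on `(a, b]` (LOWER triangular, `|det| = 1`):
`t_i = p_i (i ≤ a or i > b)`, `t_b = p_a − p_b`, `t_i = p_a − p_b p_i (a < i < b)`.  It realises the facet
`{t_a, …, t_b}` (`ε → 0`) — instances: §11 `C3` (k=4, a=1, b=3), §12 `C4` (a=0, b=3); the gap facets are `b = a+1`. -/

section RunChart
variable {M : ℕ}

/-- scaling step -/
def sigR (a b : Fin (M + 1)) (p : Fin (M + 1) → ℝ) : Fin (M + 1) → ℝ :=
  fun i => if a < i ∧ i < b then p b * p i else p i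

/-- relative-coordinate step (linear) -/
def psiR (a b : Fin (M + 1)) (q : Fin (M + 1) → ℝ) : Fin (M + 1) → ℝ :=
  fun i => if a < i ∧ i ≤ b then q a - q i else q i

/-- the run chart -/
def mapR (a b : Fin (M + 1)) (p : Fin (M + 1) → ℝ) : Fin (M + 1) → ℝ := psiR a b (sigR a b p)

/-- Auxiliary step `mapR_apply_out` (§19): map R apply out. [bookkeeping] -/
theorem mapR_apply_out {a b i : Fin (M + 1)} (h : i ≤ a ∨ b < i) (p : Fin (M + 1) → ℝ) : mapR a b p i = p i := by
  have h1 : ¬ (a < i ∧ i ≤ b) := by rintro ⟨h2, h3⟩; rcases h with h | h; exact absurd h2 (not_lt.2 h); exact absurd h3 (not_le.2 h)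
  have h2 : ¬ (a < i ∧ i < b) := fun h3 => h1 ⟨h3.1, h3.2.le⟩
  simp [mapR, psiR, sigR, h1, h2]

/-- Auxiliary step `mapR_apply_bot` (§19): map R apply bot. [bookkeeping] -/
theorem mapR_apply_bot {a b : Fin (M + 1)} (hab : a < b) (p : Fin (M + 1) → ℝ) : mapR a b p b = p a - p b := by
  simp [mapR, psiR, sigR, hab]

end RunChart
end Summit.KontsevichZagierPeriods.KontsevichZagierPeriods.Cruxes.GZNormalFormWThree.GZLadder.RungFour
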